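import Summits.Langlands.Langlands.Theorems.ExteriorSquareAscentSelfTwistedIrreducibleCliffordLemmas
import HarnessLib

/-!
# Clifford theory for a self-twisted reducible representation of dimension four — the dichotomy

Route `ExteriorSquareAscent`, crux `SelfTwistedIrreducible` (stmt-Langlands-18055), line `Sketch`,
stub `stub_cliffordDichotomy` — the purely algebraic core (file 2 of 3; lemmas in `…CliffordLemmas.lean`).

Setting: `k` an algebraically closed field, `G` a group, `H ⊴ G` a normal subgroup with an element
`g₀ ∉ H` such that `a⁻¹ b ∈ H` for `a, b ∉ H` (index two), `ε : G → kˣ` a character trivial on `H`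
with `ε(g₀) ≠ 1`, and `ρ : G → GL(V)` a SEMISIMPLE, NON-IRREDUCIBLE representation on a `4`-dimensional
`V` together with an isomorphism `T : ρ ⊗ ε ≃ ρ`.  Conclusion
(`exists_eigenbasis_or_doubled_of_twist_equiv`): either `V` has a basis of simultaneous eigenvectors
of `ρ(H)` (shape (A): `ρ|_H` is a sum of four characters), or `V = U ⊕ U'` with `G`-stable planes and
an `H`-equivariant isomorphism `U ≃ U'` (shape (B): `ρ|_H ≅ W ⊕ W`).

Proof (Clifford 1937; Curtis–Reiner I §11): `T` satisfies `T ρ(g) = ε(g)⁻¹ ρ(g) T`.  If `V` has a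
`G`-stable line `⟨u⟩`, then `⟨u, Tu⟩` is a `G`-stable plane on which `G` acts diagonally, with a
`G`-stable complement `Q`; either `Q` too has a `G`-stable line (and then a complementary one), or `Q`
is irreducible and the `G`-map `p_Q ∘ T|_Q : Q ⊗ ε → Q` is non-zero, so `Q|_H` is reducible (otherwise it
is a non-zero scalar by Schur and `ε(g₀) = 1`) and `Q = ⟨x⟩ ⊕ ⟨ρ(g₀)x⟩` with `H`-stable lines.  If `V` has
no `G`-stable line, an irreducible `G`-stable plane `U` and a complement `U'` are exchanged-or-preserved
by `T`: if a cross term `p_{U'} T|_U` or `p_U T|_{U'}` is non-zero it is an isomorphism `U ⊗ ε ≅ U'` (Schur),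
shape (B); otherwise `T` preserves `U` and `U'` and both restrict to `H` reducibly as before, shape (A).

References: A. H. Clifford, Ann. of Math. 38 (1937), Thm. 1; C. W. Curtis, I. Reiner, *Methods of
Representation Theory* I (1981), §11; J.-P. Serre, *Linear representations of finite groups*, §8.1.
-/

set_option linter.dupNamespace false -- `Summit.Langlands.Langlands` is the mandated namespace

noncomputable section

namespace Summit.Langlands.Langlands.Cruxes.SelfTwistedIrreducible.DetPinning

open Literature.RepresentationTheory.Semisimple Polynomial Module

universe u v w

variable {k : Type u} [Field k] {G : Type v} [Group G] {V : Type w} [AddCommGroup V] [Module k V]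

section Setting

variable [IsAlgClosed k] [FiniteDimensional k V]
  {H : Subgroup G} {ε : G →* kˣ} {ρ : Representation k G V}

/-- **Clifford dichotomy for a self-twisted reducible semisimple representation of dimension `4`.**
See the module docstring. [folklore] -/
theorem exists_eigenbasis_or_doubled_of_twist_equiv [H.Normal] {g₀ : G} (hg₀ : g₀ ∉ H)
    (hmul : ∀ a b : G, a ∉ H → b ∉ H → a⁻¹ * b ∈ H)
    (hε : ∀ g ∈ H, ε g = 1) (hεg₀ : ε g₀ ≠ 1) (hV : finrank k V = 4)
    [ρ.IsSemisimpleRepresentation] (hirr : ¬ ρ.IsIrreducible)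
    (T : (Literature.RepresentationTheory.Semisimple.Representation.twist ρ ε).Equiv ρ) :
    (∃ b : Basis (Fin 4) k V, ∀ g ∈ H, ∀ i, ∃ c : k, ρ g (b i) = c • b i) ∨
    (∃ (U U' : Submodule k V) (hU : ∀ g, ∀ x ∈ U, ρ g x ∈ U) (_hU' : ∀ g, ∀ x ∈ U', ρ g x ∈ U'),
      IsCompl U U' ∧ finrank k U = 2 ∧
        ∃ e : U ≃ₗ[k] U', ∀ g ∈ H, ∀ u : U, (e ⟨ρ g u, hU g u u.2⟩ : V) = ρ g (e u)) := by
  classical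
  -- ### generalities on `T`
  have hT : ∀ (g : G) (v : V), T (ρ g v) = (((ε g)⁻¹ : kˣ) : k) • ρ g (T v) := by
    intro g v
    have h := Representation.IntertwiningMap.isIntertwining _ _ T.toIntertwiningMap g v
    rw [Representation.Equiv.coe_toIntertwiningMap, Literature.RepresentationTheory.Semisimple.Representation.twist_apply_apply, map_smul] at h
    rw [← h, smul_smul, Units.inv_mul, one_smul]
  have hT' : ∀ (g : G) (v : V), ρ g (T v) = ((ε g : kˣ) : k) • T (ρ g v) := by
    intro g v; rw [hT, smul_smul, Units.mul_inv, one_smul]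
  have hTinj : Function.Injective T := T.toLinearEquiv.injective
  -- an `H`-eigenbasis from four eigenvectors
  have basisA : ∀ {P Q : Submodule k V}, Disjoint P Q → ∀ {a b c d : V}, a ∈ P → b ∈ P → c ∈ Q →
      d ∈ Q → LinearIndependent k ![a, b] → LinearIndependent k ![c, d] →
      (∀ g ∈ H, ∃ t : k, ρ g a = t • a) → (∀ g ∈ H, ∃ t : k, ρ g b = t • b) →
      (∀ g ∈ H, ∃ t : k, ρ g c = t • c) → (∀ g ∈ H, ∃ t : k, ρ g d = t • d) →
      ∃ bs : Basis (Fin 4) k V, ∀ g ∈ H, ∀ i, ∃ t : k, ρ g (bs i) = t • bs i := by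
    intro P Q hPQ a b c d ha hb hc hd hab hcd hHa hHb hHc hHd
    have hli := linearIndependent_four_of_disjoint hPQ ha hb hc hd hab hcd
    refine ⟨basisOfLinearIndependentOfCardEqFinrank hli (by rw [hV]; simp), fun g hg i => ?_⟩
    rw [coe_basisOfLinearIndependentOfCardEqFinrank]
    fin_cases i
    · exact hHa g hg
    · exact hHb g hg
    · exact hHc g hg
    · exact hHd g hg
  -- eigenvectors of all of `G` are eigenvectors of `H`
  have eigG : ∀ {x : V}, (∀ g, ρ g x ∈ Submodule.span k {x}) → ∀ g ∈ H, ∃ t : k, ρ g x = t • x :=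
    fun hx g _ => by
      obtain ⟨t, ht⟩ := Submodule.mem_span_singleton.mp (hx g); exact ⟨t, ht.symm⟩
  by_cases hline : ∃ u : V, u ≠ 0 ∧ ∀ g, ρ g u ∈ Submodule.span k {u}
  · -- ### Case 1: a `G`-stable line `⟨u⟩`
    obtain ⟨u, hu0, hu⟩ := hline
    have hchar : ∀ g, ∃ a : k, ρ g u = a • u := fun g => by
      obtain ⟨a, ha⟩ := Submodule.mem_span_singleton.mp (hu g); exact ⟨a, ha.symm⟩
    set u' : V := T u with hu'def
    have hu'0 : u' ≠ 0 := fun h => hu0 (hTinj (by rw [← hu'def, h, map_zero]))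
    have hu' : ∀ g, ρ g u' ∈ Submodule.span k {u'} := by
      intro g
      obtain ⟨a, ha⟩ := hchar g
      rw [hu'def, hT', ha, map_smul, smul_smul]
      exact Submodule.smul_mem _ _ (Submodule.mem_span_singleton_self _)
    -- `u, u'` independent
    have huu' : LinearIndependent k ![u, u'] := by
      refine linearIndependent_pair_of_not_mem_span hu0 fun hmem => ?_
      obtain ⟨a, ha⟩ := Submodule.mem_span_singleton.mp hmem
      obtain ⟨c, hc⟩ := hchar g₀
      have hc0 : c ≠ 0 := by
        rintro rfl
        rw [zero_smul] at hc
        exact hu0 (rep_apply_eq_zero hc)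
      -- `ρ g₀ u' = ε g₀ c u'` and `= a ρ g₀ u = a c u = c u'`
      have h1 : ρ g₀ u' = (((ε g₀ : kˣ) : k) * c) • u' := by
        rw [hu'def, hT', hc, map_smul, smul_smul]
      have h2 : ρ g₀ u' = c • u' := by
        rw [← ha, map_smul, hc, smul_smul, mul_comm, ← smul_smul]
      have h3 : ((((ε g₀ : kˣ) : k) * c) - c) • u' = 0 := by rw [sub_smul, ← h1, ← h2, sub_self]
      rcases smul_eq_zero.mp h3 with h | h
      · apply hεg₀
        have : (((ε g₀ : kˣ) : k) - 1) * c = 0 := by rw [sub_mul, one_mul]; exact h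
        rcases mul_eq_zero.mp this with h4 | h4
        · exact Units.ext (by rw [Units.val_one]; exact sub_eq_zero.mp h4)
        · exact absurd h4 hc0
      · exact absurd h hu'0
    -- the `G`-stable plane `P = ⟨u, u'⟩`
    set P : Submodule k V := Submodule.span k {u, u'} with hPdef
    have hPst : ∀ g, ∀ x ∈ P, ρ g x ∈ P := by
      intro g x hx
      refine Submodule.span_induction (fun y hy => ?_) (by rw [map_zero]; exact P.zero_mem)
        (fun a b _ _ ha hb => by rw [map_add]; exact P.add_mem ha hb)
        (fun t a _ ha => by rw [map_smul]; exact P.smul_mem t ha) hx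
      rcases hy with rfl | rfl
      · exact Submodule.span_mono (by simp) (hu g)
      · exact Submodule.span_mono (by simp) (hu' g)
    have hPrank : finrank k P = 2 := by
      have h := finrank_span_eq_card huu'
      have hr : Set.range ![u, u'] = {u, u'} := by
        ext y; simp only [Matrix.range_cons, Matrix.range_empty, Set.union_empty, Set.union_singleton,
          Set.mem_insert_iff, Set.mem_singleton_iff]; tauto
      rw [hr] at h
      simpa using h
    have huP : u ∈ P := Submodule.subset_span (by simp)
    have hu'P : u' ∈ P := Submodule.subset_span (by simp)
    obtain ⟨Q, hQst, hPQ⟩ := exists_isCompl_stable hPst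
    have hQrank : finrank k Q = 2 := by
      have := Submodule.finrank_add_eq_of_isCompl hPQ
      rw [hPrank, hV] at this
      omega
    by_cases hQline : ∃ x ∈ Q, x ≠ 0 ∧ ∀ g, ρ g x ∈ Submodule.span k {x}
    · -- #### Case 1a: `Q` has a `G`-stable line; a complementary one gives four `G`-lines
      obtain ⟨x, hxQ, hx0, hx⟩ := hQline
      set X : Submodule k V := Submodule.span k {x} with hXdef
      have hXst : ∀ g, ∀ y ∈ X, ρ g y ∈ X := by
        intro g y hy
        obtain ⟨a, rfl⟩ := Submodule.mem_span_singleton.mp hy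
        rw [map_smul]; exact X.smul_mem a (hx g)
      have hXQ : X ≤ Q := (Submodule.span_singleton_le_iff_mem x Q).mpr hxQ
      -- complement of `P ⊔ X`
      have hPXst : ∀ g, ∀ y ∈ P ⊔ X, ρ g y ∈ P ⊔ X := by
        intro g y hy
        obtain ⟨a, ha, b, hb, rfl⟩ := Submodule.mem_sup.mp hy
        rw [map_add]
        exact Submodule.add_mem _ (Submodule.mem_sup_left (hPst g a ha))
          (Submodule.mem_sup_right (hXst g b hb))
      obtain ⟨R, hRst, hPXR⟩ := exists_isCompl_stable hPXst
      have hXrank : finrank k X = 1 := finrank_span_singleton hx0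
      have hPX : Disjoint P X := hPQ.disjoint.mono_right hXQ
      have hPXrank : finrank k ↥(P ⊔ X) = 3 := by
        have h := Submodule.finrank_sup_add_finrank_inf_eq P X
        rw [disjoint_iff.mp hPX, finrank_bot, add_zero, hPrank, hXrank] at h
        omega
      have hRrank : finrank k R = 1 := by
        have := Submodule.finrank_add_eq_of_isCompl hPXR
        rw [hPXrank, hV] at this
        omega
      obtain ⟨y, hyR, hy0, hy⟩ := exists_line_of_finrank_eq_one hRst hRrank
      -- `x, y` independent inside `Q' := X ⊔ R`, disjoint from `P`
      have hyX : y ∉ X := by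
        intro h
        have : y ∈ (P ⊔ X) ⊓ R := ⟨Submodule.mem_sup_right h, hyR⟩
        rw [disjoint_iff.mp hPXR.disjoint] at this
        exact hy0 ((Submodule.mem_bot k).mp this)
      have hxy : LinearIndependent k ![x, y] := linearIndependent_pair_of_not_mem_span hx0 hyX
      have hdisj : Disjoint P (X ⊔ R) := by
        rw [Submodule.disjoint_def]
        intro z hzP hz
        obtain ⟨a, ha, b, hb, rfl⟩ := Submodule.mem_sup.mp hz
        have hb' : b ∈ (P ⊔ X) ⊓ R := by
          refine ⟨?_, hb⟩
          have : a + b - a ∈ P ⊔ X :=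
            Submodule.sub_mem _ (Submodule.mem_sup_left hzP) (Submodule.mem_sup_right ha)
          rwa [add_sub_cancel_left] at this
        rw [disjoint_iff.mp hPXR.disjoint] at hb'
        have hb0 : b = 0 := (Submodule.mem_bot k).mp hb'
        rw [hb0, add_zero] at hzP ⊢
        have : a ∈ P ⊓ X := ⟨hzP, ha⟩
        rw [disjoint_iff.mp hPX] at this
        exact (Submodule.mem_bot k).mp this
      left
      exact basisA hdisj huP hu'P (Submodule.mem_sup_left (Submodule.mem_span_singleton_self x))
        (Submodule.mem_sup_right hyR) huu' hxy (eigG hu) (eigG hu') (eigG hx) (eigG hy)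
    · -- #### Case 1b: `Q` is irreducible; `p_Q ∘ T|_Q` is a non-zero `ε`-map
      push Not at hQline
      have hQnoline : ∀ x ∈ Q, x ≠ 0 → (∀ g, ρ g x ∈ Submodule.span k {x}) → False :=
        fun x hxQ hx0 hx => by obtain ⟨g, hg⟩ := hQline x hxQ hx0; exact hg (hx g)
      have hQP : IsCompl Q P := hPQ.symm
      set S : Q →ₗ[k] Q := (Q.projectionOnto P hQP).comp (T.toLinearMap.comp Q.subtype) with hSdef
      have hSapp : ∀ q : Q, S q = Q.projectionOnto P hQP (T q) := fun q => rfl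
      have hS : ∀ (g : G) (q : Q), (S ⟨ρ g q, hQst g q q.2⟩ : V) =
          (((ε g)⁻¹ : kˣ) : k) • ρ g (S q) := by
        intro g q
        rw [hSapp, hSapp, Submodule.coe_mk, hT, map_smul, Submodule.coe_smul,
          projectionOnto_rep hQP hQst hPst]
      have hS0 : S ≠ 0 := by
        intro hS0
        -- then `T(Q) ≤ P`, hence `= P ∋ u' = T u`, so `u ∈ Q`
        have hTQ : Q.map T.toLinearMap ≤ P := by
          rintro _ ⟨q, hq, rfl⟩
          have : S ⟨q, hq⟩ = 0 := by rw [hS0, LinearMap.zero_apply]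
          rw [hSapp] at this
          exact (Submodule.projectionOnto_apply_eq_zero_iff hQP).mp this
        have hTQrank : finrank k ↥(Q.map T.toLinearMap) = 2 := by
          rw [← hQrank]
          exact (LinearEquiv.finrank_eq (Submodule.equivMapOfInjective _ hTinj Q)).symm
        have hTQP : Q.map T.toLinearMap = P :=
          Submodule.eq_of_le_of_finrank_eq hTQ (by rw [hTQrank, hPrank])
        have : u' ∈ Q.map T.toLinearMap := by rw [hTQP]; exact hu'P
        obtain ⟨q, hq, hqu⟩ := this
        have hqu' : q = u := hTinj hqu
        rw [hqu'] at hq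
        have : u ∈ P ⊓ Q := ⟨huP, hq⟩
        rw [disjoint_iff.mp hPQ.disjoint] at this
        exact hu0 ((Submodule.mem_bot k).mp this)
      have hQ0 : Q ≠ ⊥ := by
        intro h; rw [h, finrank_bot] at hQrank; exact absurd hQrank (by norm_num)
      have hred : ¬ Representation.IsIrreducible
          ((⟨Q, fun g _ hx => hQst g _ hx⟩ : Subrepresentation ρ).toRepresentation.comp H.subtype) :=
        fun hirrQ => false_of_epsMap_of_irreducible hε hεg₀ hQst hQ0 hS hS0 hirrQ
      obtain ⟨x, x', hxQ, hx'Q, hxx', hxH, hx'H⟩ :=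
        exists_eigenpair_of_not_irreducible hg₀ hmul hQst hQrank hQnoline hred
      left
      exact basisA hPQ.disjoint huP hu'P hxQ hx'Q huu' hxx' (eigG hu) (eigG hu') hxH hx'H
  · -- ### Case 2: no `G`-stable line
    push Not at hline
    have hnoline : ∀ x : V, x ≠ 0 → (∀ g, ρ g x ∈ Submodule.span k {x}) → False :=
      fun x hx0 hx => by obtain ⟨g, hg⟩ := hline x hx0; exact hg (hx g)
    -- a `G`-stable plane `U` and a `G`-stable complement `U'`
    obtain ⟨U, hUst, hUrank⟩ : ∃ U : Submodule k V, (∀ g, ∀ x ∈ U, ρ g x ∈ U) ∧ finrank k U = 2 := by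
      have hirr' : ¬ IsSimpleOrder (Subrepresentation ρ) := hirr
      obtain ⟨W, hW0, hW1⟩ : ∃ W : Subrepresentation ρ, W ≠ ⊥ ∧ W ≠ ⊤ := by
        by_contra hcon
        push Not at hcon
        have hbt : (⊥ : Subrepresentation ρ) ≠ ⊤ := by
          intro h
          have h' := congrArg Subrepresentation.toSubmodule h
          change (⊥ : Submodule k V) = ⊤ at h'
          have : finrank k (⊤ : Submodule k V) = 0 := by rw [← h', finrank_bot]
          rw [finrank_top, hV] at this
          exact absurd this (by norm_num)
        haveI : Nontrivial (Subrepresentation ρ) := ⟨⟨⊥, ⊤, hbt⟩⟩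
        exact hirr' ⟨fun W => or_iff_not_imp_left.mpr (hcon W)⟩
      have hWst : ∀ g, ∀ x ∈ W.toSubmodule, ρ g x ∈ W.toSubmodule :=
        fun g x hx => W.apply_mem_toSubmodule g hx
      have hd0 : finrank k W.toSubmodule ≠ 0 := fun h =>
        hW0 (Subrepresentation.toSubmodule_injective (Submodule.finrank_eq_zero.mp h))
      have hd4 : finrank k W.toSubmodule < 4 := by
        rw [← hV, ← finrank_top (R := k) (M := V)]
        exact Submodule.finrank_lt_finrank_of_lt (lt_top_iff_ne_top.mpr fun h =>
          hW1 (Subrepresentation.toSubmodule_injective h))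
      have hd1 : finrank k W.toSubmodule ≠ 1 := by
        intro h1
        obtain ⟨x, -, hx0, hx⟩ := exists_line_of_finrank_eq_one hWst h1
        exact hnoline x hx0 hx
      have hd3 : finrank k W.toSubmodule ≠ 3 := by
        intro h3
        obtain ⟨W', hW'st, hWW'⟩ := exists_isCompl_stable hWst
        have h1 : finrank k W' = 1 := by
          have := Submodule.finrank_add_eq_of_isCompl hWW'
          rw [h3, hV] at this; omega
        obtain ⟨x, -, hx0, hx⟩ := exists_line_of_finrank_eq_one hW'st h1
        exact hnoline x hx0 hx
      exact ⟨W.toSubmodule, hWst, by omega⟩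
    obtain ⟨U', hU'st, hUU'⟩ := exists_isCompl_stable hUst
    have hU'rank : finrank k U' = 2 := by
      have := Submodule.finrank_add_eq_of_isCompl hUU'
      rw [hUrank, hV] at this; omega
    have hUnl : ∀ x ∈ U, x ≠ 0 → (∀ g, ρ g x ∈ Submodule.span k {x}) → False :=
      fun x _ hx0 hx => hnoline x hx0 hx
    have hU'nl : ∀ x ∈ U', x ≠ 0 → (∀ g, ρ g x ∈ Submodule.span k {x}) → False :=
      fun x _ hx0 hx => hnoline x hx0 hx
    have hU0 : U ≠ ⊥ := by
      intro h; rw [h, finrank_bot] at hUrank; exact absurd hUrank (by norm_num)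
    have hU'0 : U' ≠ ⊥ := by
      intro h; rw [h, finrank_bot] at hU'rank; exact absurd hU'rank (by norm_num)
    -- the cross terms `S₂ : U → U'` and `S₃ : U' → U`
    -- (generic construction, used twice with the roles of `U`, `U'` exchanged)
    have cross : ∀ {A B : Submodule k V} (hA : ∀ g, ∀ x ∈ A, ρ g x ∈ A)
        (hB : ∀ g, ∀ x ∈ B, ρ g x ∈ B) (hAB : IsCompl A B), finrank k A = 2 →
        (∀ x ∈ A, x ≠ 0 → (∀ g, ρ g x ∈ Submodule.span k {x}) → False) →
        (∀ x ∈ B, x ≠ 0 → (∀ g, ρ g x ∈ Submodule.span k {x}) → False) →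
        (B.projectionOnto A hAB.symm).comp (T.toLinearMap.comp A.subtype) ≠ 0 →
        ∃ e : A ≃ₗ[k] B, ∀ g ∈ H, ∀ a : A, (e ⟨ρ g a, hA g a a.2⟩ : V) = ρ g (e a) := by
      intro A B hA hB hAB hArank hAnl hBnl hS2
      set Aρ : Subrepresentation ρ := ⟨A, fun g _ hx => hA g _ hx⟩
      set Bρ : Subrepresentation ρ := ⟨B, fun g _ hx => hB g _ hx⟩
      haveI hAirr : Aρ.toRepresentation.IsIrreducible := isIrreducible_of_noline hA hArank hAnl
      have hBrank : finrank k B = 2 := by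
        have := Submodule.finrank_add_eq_of_isCompl hAB
        rw [hArank, hV] at this; omega
      haveI hBirr : Bρ.toRepresentation.IsIrreducible := isIrreducible_of_noline hB hBrank hBnl
      set S₂ : A →ₗ[k] B := (B.projectionOnto A hAB.symm).comp (T.toLinearMap.comp A.subtype)
      have hS₂app : ∀ a : A, S₂ a = B.projectionOnto A hAB.symm (T a) := fun a => rfl
      -- `S₂` intertwines `Aρ ⊗ ε → Bρ`
      have hint : ∀ (g : G) (a : A),
          S₂ (Literature.RepresentationTheory.Semisimple.Representation.twist Aρ.toRepresentation ε g a) = Bρ.toRepresentation g (S₂ a) := by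
        intro g a
        apply Subtype.ext
        rw [Literature.RepresentationTheory.Semisimple.Representation.twist_apply_apply, map_smul, Submodule.coe_smul, hS₂app, hS₂app]
        change ((ε g : kˣ) : k) • (B.projectionOnto A hAB.symm (T (ρ g a)) : V) =
          ρ g (B.projectionOnto A hAB.symm (T a))
        rw [hT, map_smul, Submodule.coe_smul, smul_smul, Units.mul_inv, one_smul,
          projectionOnto_rep hAB.symm hB hA]
      let I : Representation.IntertwiningMap (Literature.RepresentationTheory.Semisimple.Representation.twist Aρ.toRepresentation ε)
          Bρ.toRepresentation :=
        LinearMap.intertwiningMap_of_isIntertwiningMap _ _ S₂ hint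
      haveI : (Literature.RepresentationTheory.Semisimple.Representation.twist Aρ.toRepresentation ε).IsIrreducible := inferInstance
      rcases Representation.IsIrreducible.bijective_or_eq_zero I with hbij | hzero
      · refine ⟨LinearEquiv.ofBijective S₂ hbij, fun g hg a => ?_⟩
        rw [LinearEquiv.ofBijective_apply, LinearEquiv.ofBijective_apply, hS₂app, hS₂app,
          Submodule.coe_mk, hT, hε g hg, inv_one, Units.val_one, one_smul,
          projectionOnto_rep hAB.symm hB hA]
      · exfalso
        apply hS2
        apply LinearMap.ext
        intro a
        have := congrArg (fun J : Representation.IntertwiningMap _ _ => J a) hzero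
        exact this
    by_cases hS₂ : (U'.projectionOnto U hUU'.symm).comp (T.toLinearMap.comp U.subtype) ≠ 0
    · obtain ⟨e, he⟩ := cross hUst hU'st hUU' hUrank hUnl hU'nl hS₂
      right
      exact ⟨U, U', hUst, hU'st, hUU', hUrank, e, he⟩
    by_cases hS₃ : (U.projectionOnto U' hUU'.symm.symm).comp (T.toLinearMap.comp U'.subtype) ≠ 0
    · obtain ⟨e, he⟩ := cross hU'st hUst hUU'.symm hU'rank hU'nl hUnl hS₃
      right
      exact ⟨U', U, hU'st, hUst, hUU'.symm, hU'rank, e, he⟩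
    -- both cross terms vanish: `T` preserves `U` and `U'`
    push Not at hS₂ hS₃
    have hTU : ∀ x ∈ U, T x ∈ U := by
      intro x hx
      have : (U'.projectionOnto U hUU'.symm).comp (T.toLinearMap.comp U.subtype) ⟨x, hx⟩ = 0 := by
        rw [hS₂, LinearMap.zero_apply]
      exact (Submodule.projectionOnto_apply_eq_zero_iff hUU'.symm).mp this
    have hTU' : ∀ x ∈ U', T x ∈ U' := by
      intro x hx
      have : (U.projectionOnto U' hUU'.symm.symm).comp (T.toLinearMap.comp U'.subtype) ⟨x, hx⟩ = 0 := by
        rw [hS₃, LinearMap.zero_apply]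
      exact (Submodule.projectionOnto_apply_eq_zero_iff hUU'.symm.symm).mp this
    -- the restrictions of `T` are non-zero `ε`-maps, so `U|_H`, `U'|_H` are reducible
    have epair : ∀ {A : Submodule k V} (hA : ∀ g, ∀ x ∈ A, ρ g x ∈ A), finrank k A = 2 →
        (∀ x ∈ A, x ≠ 0 → (∀ g, ρ g x ∈ Submodule.span k {x}) → False) → A ≠ ⊥ →
        (hTA : ∀ x ∈ A, T x ∈ A) →
        ∃ x x' : V, x ∈ A ∧ x' ∈ A ∧ LinearIndependent k ![x, x'] ∧
          (∀ g ∈ H, ∃ c : k, ρ g x = c • x) ∧ (∀ g ∈ H, ∃ c : k, ρ g x' = c • x') := by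
      intro A hA hArank hAnl hA0 hTA
      set S₁ : A →ₗ[k] A := T.toLinearMap.restrict (p := A) (q := A) fun x hx => hTA x hx
      have hS₁ : ∀ (g : G) (a : A), (S₁ ⟨ρ g a, hA g a a.2⟩ : V) =
          (((ε g)⁻¹ : kˣ) : k) • ρ g (S₁ a) := by
        intro g a
        rw [LinearMap.coe_restrict_apply, LinearMap.coe_restrict_apply]
        exact hT g a
      have hS₁0 : S₁ ≠ 0 := by
        intro h0
        obtain ⟨a, haA, ha0⟩ := (Submodule.ne_bot_iff A).mp hA0
        have : (S₁ ⟨a, haA⟩ : V) = 0 := by rw [h0, LinearMap.zero_apply, Submodule.coe_zero]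
        rw [LinearMap.coe_restrict_apply] at this
        exact ha0 (hTinj (by rw [map_zero]; exact this))
      have hred : ¬ Representation.IsIrreducible
          ((⟨A, fun g _ hx => hA g _ hx⟩ : Subrepresentation ρ).toRepresentation.comp H.subtype) :=
        fun hirrA => false_of_epsMap_of_irreducible hε hεg₀ hA hA0 hS₁ hS₁0 hirrA
      exact exists_eigenpair_of_not_irreducible hg₀ hmul hA hArank hAnl hred
    obtain ⟨x, x', hx, hx', hxx', hxH, hx'H⟩ := epair hUst hUrank hUnl hU0 hTU
    obtain ⟨y, y', hy, hy', hyy', hyH, hy'H⟩ := epair hU'st hU'rank hU'nl hU'0 hTU'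
    left
    exact basisA hUU'.disjoint hx hx' hy hy' hxx' hyy' hxH hx'H hyH hy'H

end Setting

end Summit.Langlands.Langlands.Cruxes.SelfTwistedIrreducible.DetPinning

end
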